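import Literature.AnabelianGeometry.EtaleTheta.ThetaRigidity
import Literature.AnabelianGeometry.EtaleTheta.Discharge.Sec2EnvelopeLemmas
import Literature.AnabelianGeometry.EtaleTheta.Discharge.Sec2IsoLift

/-!
# [EtTh] Prop 2.14 (i) REDUCED to the commutator structure of the theta group
# (proof-only companion)

Mochizuki, *The Étale Theta Function …* [EtTh], Publ. RIMS 45 (2009), §2, Prop 2.14 (i) and its
proof, PRIMS text pp.49–51 (locators `p.N` = PDF pages; bib key `MochizukiEtTh2009`): "the subset
`{γ(β)·β⁻¹}` … coincides with the image of the tautological section of `(l·Δ_Θ)[μ_N] ↠ (l·Δ_Θ)`"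
— the printed proof computes `γ(β)·β⁻¹` for `γ` a Kummer shift (trivial on `Δ_Y[μ_N]`) and for
`γ` induced by `Gal(Y/X)` (a commutator in the theta group).

PROOF-ONLY companion of `MonoThetaEnv.lean` / `ThetaRigidity.lean` (seat abc-iut-L2-t2), unit
W2-L2-06 / Cor 2.18 (abc-iut-L2-t10). Main result `RigidData.prop214_i_of_commutators`: the named
fact `RigidData.Prop214_i` FOLLOWS from two explicit statements about the data —

* `hslim` : an element of `Π^tp_X` whose conjugation induces the identity of `G_K` on `aug(Π^tp_Y)`
  lies in `Δ_X` (slimness of `G_K` relative to the open image of `Π^tp_Y`; [SemiAnbd] Ex 3.10 /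
  local class field theory input);
* `hcomm` : `(l·Δ_Θ)·Ker = {[z, b]·k | z ∈ Δ_X, b ∈ Δ_Y, k ∈ Ker}` — the commutator structure of the
  theta group `Δ^Θ_X` for `X` of type `(1, (ℤ/lℤ)^Θ)` ("well-known structure of the theta-group",
  cf. Prop 2.12 (i), p.45),

via the STRUCTURE THEOREM `ThetaEnvData.aut_shape_of_mk_mem_DY` (PROVED here by induction over the
closure `D_Y = ⟨Kummer shifts, Gal(Y/X)⟩ · Inn`; the `Π^tp_Y`-component alone is also seat L2-d1's
`ThetaEnvData.exists_over_of_mk_mem_DY` in `Sec2IsoLift`, whose `conjX_mem_contMulAut` we reuse):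
every bi-continuous automorphism `γ` of
`Π^tp_Y[μ_N]` whose class lies in `D_Y` acts as `(a, g) ↦ (χ(z)·a·ε(g), z g z⁻¹)` for some
`z ∈ Π^tp_X`, with `ε` trivial on `Δ_Y`. Both hypotheses are to be supplied by the adapter from the
§1 setting (abc-iut-L2-t8); nothing of seat t2's files is edited or restated.
-/

namespace Literature.AnabelianGeometry.EtaleTheta

universe u

namespace ThetaEnvData

variable {N : ℕ+} (T : ThetaEnvData.{u} N)

/-- An element of `Aut_top(Π^tp_Y[μ_N])` whose class lies in `D_Y` belongs to the subgroup generated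
by the Kummer shifts, the `Gal(Y/X)`-conjugations and the inner automorphisms.
[cite: MochizukiEtTh2009, Def 2.13(i) p.47] -/
theorem mem_closure_of_mk_mem_DY (c : contMulAut T.env) (hc : TopOut.mk _ c ∈ T.DY) :
    c ∈ Subgroup.closure
      ({c : contMulAut T.env |
          (∃ (δ : T.G → T.mu) (hδ : CycEnvelope.IsEnvCocycle T.augY T.chi (δ ∘ T.augY)),
            (c : MulAut T.env) = CycEnvelope.shift hδ) ∨
          ∃ g : T.PiX, (c : MulAut T.env) = T.conjX g} ∪
        (innerContAut T.env : Set (contMulAut T.env))) := by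
  set S₀ : Set (contMulAut T.env) := {c : contMulAut T.env |
      (∃ (δ : T.G → T.mu) (hδ : CycEnvelope.IsEnvCocycle T.augY T.chi (δ ∘ T.augY)),
        (c : MulAut T.env) = CycEnvelope.shift hδ) ∨
      ∃ g : T.PiX, (c : MulAut T.env) = T.conjX g} with hS₀
  have hgen : T.kummerOut ∪ T.galOut ⊆ TopOut.mk _ '' S₀ := by
    rintro d (⟨δ, hδ, hcδ, rfl⟩ | ⟨g, hcg, rfl⟩)
    · exact ⟨⟨_, hcδ⟩, Or.inl ⟨δ, hδ, rfl⟩, rfl⟩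
    · exact ⟨⟨_, hcg⟩, Or.inr ⟨g, rfl⟩, rfl⟩
  have hDY : T.DY ≤ (Subgroup.closure S₀).map (TopOut.mk _) := by
    unfold DY
    rw [MonoidHom.map_closure]
    exact Subgroup.closure_mono hgen
  have hc' : c ∈ ((Subgroup.closure S₀).map (TopOut.mk _)).comap (TopOut.mk _) := hDY hc
  rw [Subgroup.comap_map_eq, QuotientGroup.ker_mk'] at hc'
  rw [Subgroup.closure_union, Subgroup.closure_eq]
  exact hc'

/-- **Structure of the `D_Y`-automorphisms**: every bi-continuous automorphism `γ` of
`Π^tp_Y[μ_N]` whose class lies in `D_Y` is of the shape `(a, g) ↦ (χ(z)·a·ε(g), z g z⁻¹)` for some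
`z ∈ Π^tp_X`, with `ε(g) = γ(s^alg(g))_μ` trivial on `Δ_Y` — Kummer shifts are trivial on
`Δ_Y[μ_N]`, `Gal(Y/X)` and inner automorphisms act through conjugation by `Π^tp_X` (proof of
Prop 2.14 (i), p.50). [cite: MochizukiEtTh2009, Prop 2.14(i) p.49] -/
theorem aut_shape_of_mk_mem_DY (c : contMulAut T.env) (hc : TopOut.mk _ c ∈ T.DY) :
    ∃ z : T.PiX,
      (∀ x : T.env, (((c : MulAut T.env) x).right : T.PiX) = z * (x.right : T.PiX) * z⁻¹) ∧
      (∀ a : T.mu, (c : MulAut T.env) (CycEnvelope.inMu T.augY T.chi a) =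
        CycEnvelope.inMu T.augY T.chi (T.chi (T.aug z) a)) ∧
      (∀ b : T.PiY, T.augY b = 1 →
        ((c : MulAut T.env) (CycEnvelope.algSection T.augY T.chi b)).left = 1) := by
  have hmem := T.mem_closure_of_mk_mem_DY c hc
  -- decomposition of an element of the envelope
  have hdec : ∀ x : T.env, x = CycEnvelope.inMu T.augY T.chi x.left *
      CycEnvelope.algSection T.augY T.chi x.right :=
    fun x => (CycEnvelope.inMu_mul_algSection T.augY T.chi x).symm
  have hχ : ∀ (y : T.PiX) (m : T.mu), T.chi (T.aug y) (T.chi (T.aug y⁻¹) m) = m := by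
    intro y m
    rw [← MulAut.mul_apply, ← map_mul, ← map_mul, mul_inv_cancel, map_one, map_one,
      MulAut.one_apply]
  refine Subgroup.closure_induction (p := fun (c : contMulAut T.env) _ => ∃ z : T.PiX,
      (∀ x : T.env, (((c : MulAut T.env) x).right : T.PiX) = z * (x.right : T.PiX) * z⁻¹) ∧
      (∀ a : T.mu, (c : MulAut T.env) (CycEnvelope.inMu T.augY T.chi a) =
        CycEnvelope.inMu T.augY T.chi (T.chi (T.aug z) a)) ∧
      (∀ b : T.PiY, T.augY b = 1 →
        ((c : MulAut T.env) (CycEnvelope.algSection T.augY T.chi b)).left = 1))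
    ?_ ⟨1, by simp, by simp, by simp⟩ ?_ ?_ hmem
  · -- generators
    rintro c ((⟨δ, hδ, hcδ⟩ | ⟨g, hcg⟩) | hinn)
    · -- Kummer shift
      refine ⟨1, fun x => ?_, fun a => ?_, fun b hb => ?_⟩
      · rw [hcδ]; simp
      · rw [hcδ, CycEnvelope.shift_inMu]; simp
      · rw [hcδ, CycEnvelope.shift_apply]
        have h1 : δ 1 = 1 := by
          have := CycEnvelope.IsEnvCocycle.apply_one hδ
          simpa using this
        have hb' : T.aug (b : T.PiX) = 1 := hb
        simp [hb', h1]
    · -- `Gal(Y/X)`-conjugation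
      refine ⟨g, fun x => ?_, fun a => ?_, fun b hb => ?_⟩
      · rw [hcg]; rfl
      · rw [hcg]; ext <;> simp [conjX]
      · rw [hcg]; simp [conjX]
    · -- inner automorphism by `e ∈ Π^tp_Y[μ_N]`
      obtain ⟨e, he⟩ := MonoidHom.mem_range.mp (Subgroup.mem_subgroupOf.mp hinn)
      refine ⟨(e.right : T.PiX), fun x => ?_, fun a => ?_, fun b hb => ?_⟩
      · rw [← he]; simp [MulAut.conj_apply]
      · rw [← he, MulAut.conj_apply]
        ext
        · simp only [SemidirectProduct.mul_left, SemidirectProduct.mul_right,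
            SemidirectProduct.inv_left, SemidirectProduct.left_inl, SemidirectProduct.right_inl,
            MonoidHom.coe_comp, Function.comp_apply, Subgroup.coe_subtype, mul_one, map_inv]
          rw [← MulAut.mul_apply, mul_inv_cancel, MulAut.one_apply, mul_inv_cancel_comm]
        · simp
      · rw [← he, MulAut.conj_apply]
        have hb' : T.aug ((e.right : T.PiX) * b * (e.right : T.PiX)⁻¹) = 1 := by
          rw [map_mul, map_mul, map_inv, show T.aug (b : T.PiX) = 1 from hb, mul_one,
            mul_inv_cancel]
        simp only [SemidirectProduct.mul_left, SemidirectProduct.mul_right,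
          SemidirectProduct.inv_left, SemidirectProduct.left_inr, SemidirectProduct.right_inr,
          MonoidHom.coe_comp, Function.comp_apply, Subgroup.coe_subtype, map_one, mul_one,
          Subgroup.coe_mul]
        rw [← MulAut.mul_apply, ← map_mul, ← map_mul, Subgroup.coe_inv, hb', map_one,
          MulAut.one_apply, mul_inv_cancel]
  · -- products
    rintro c₁ c₂ - - ⟨z₁, hr₁, hμ₁, hv₁⟩ ⟨z₂, hr₂, hμ₂, hv₂⟩
    refine ⟨z₁ * z₂, fun x => ?_, fun a => ?_, fun b hb => ?_⟩
    · change ((((c₁ : MulAut T.env) ((c₂ : MulAut T.env) x)).right : T.PiY) : T.PiX) = _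
      rw [hr₁, hr₂]; group
    · change (c₁ : MulAut T.env) ((c₂ : MulAut T.env) _) = _
      rw [hμ₂, hμ₁, map_mul, map_mul, MulAut.mul_apply]
    · change ((c₁ : MulAut T.env) ((c₂ : MulAut T.env) _)).left = 1
      set y := (c₂ : MulAut T.env) (CycEnvelope.algSection T.augY T.chi b) with hy
      have hyb : T.augY y.right = 1 := by
        change T.aug ((y.right : T.PiY) : T.PiX) = 1
        rw [hy, hr₂, SemidirectProduct.right_inr, map_mul, map_mul, map_inv,
          show T.aug ((b : T.PiY) : T.PiX) = 1 from hb, mul_one, mul_inv_cancel]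
      have hy' : y = CycEnvelope.algSection T.augY T.chi y.right := by
        conv_lhs => rw [hdec y]
        rw [hy, hv₂ b hb, map_one, one_mul]
      rw [hy', hv₁ _ hyb]
  · -- inverses
    rintro c - ⟨z, hr, hμ, hv⟩
    have hinv : ∀ x, (c : MulAut T.env) (((c⁻¹ : contMulAut T.env) : MulAut T.env) x) = x :=
      fun x => MulEquiv.apply_symm_apply _ x
    refine ⟨z⁻¹, fun x => ?_, fun a => ?_, fun b hb => ?_⟩
    · have h := hr (((c⁻¹ : contMulAut T.env) : MulAut T.env) x)
      rw [hinv] at h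
      rw [h]; group
    · apply (c : MulAut T.env).injective
      rw [hinv, hμ, hχ]
    · set y := ((c⁻¹ : contMulAut T.env) : MulAut T.env) (CycEnvelope.algSection T.augY T.chi b)
        with hy
      have hyr : ((y.right : T.PiY) : T.PiX) = z⁻¹ * b * z := by
        rw [hy]
        have h := hr (((c⁻¹ : contMulAut T.env) : MulAut T.env)
          (CycEnvelope.algSection T.augY T.chi b))
        rw [hinv, SemidirectProduct.right_inr] at h
        rw [h]; group
      have hyb : T.augY y.right = 1 := by
        change T.aug ((y.right : T.PiY) : T.PiX) = 1
        rw [hyr, map_mul, map_mul, map_inv, show T.aug ((b : T.PiY) : T.PiX) = 1 from hb,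
          mul_one, inv_mul_cancel]
      have h1 : CycEnvelope.algSection T.augY T.chi b =
          CycEnvelope.inMu T.augY T.chi (T.chi (T.aug z) y.left) *
            (c : MulAut T.env) (CycEnvelope.algSection T.augY T.chi y.right) := by
        rw [← hinv (CycEnvelope.algSection T.augY T.chi b), ← hy]
        conv_lhs => rw [hdec y]
        rw [map_mul, hμ]
      have h2 := congrArg SemidirectProduct.left h1
      rw [SemidirectProduct.mul_left, hv _ hyb] at h2
      simp only [SemidirectProduct.left_inr, SemidirectProduct.left_inl,
        SemidirectProduct.right_inl, map_one, mul_one] at h2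
      -- h2 : 1 = χ z y.left
      have h3 := congrArg (T.chi (T.aug z⁻¹)) h2
      rw [map_one, ← MulAut.mul_apply, ← map_mul, ← map_mul, inv_mul_cancel, map_one, map_one,
        MulAut.one_apply] at h3
      exact h3.symm

end ThetaEnvData

namespace RigidData

variable {N : ℕ+} {l : ℕ} (R : RigidData.{u} N l)

/-- **Prop 2.14 (i) DISCHARGED modulo the commutator structure of the theta group**: if (a) an
element of `Π^tp_X` centralising `G_K` on the image of `Π^tp_Y` lies in `Δ_X` (`hslim`) and (b)
`(l·Δ_Θ)·Ker` is exactly the set of commutators `[z, b]·k`, `z ∈ Δ_X`, `b ∈ Δ_Y`, `k ∈ Ker`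
(`hcomm`), then the named fact `Prop214_i` holds: for `γ` a `D_Y`-automorphism over `G_K` and
`β ∈ Δ_Y[μ_N]`, `γ(β)·β⁻¹ = s^alg([z, β̄])` with `z ∈ Δ_X` (by `aut_shape_of_mk_mem_DY` and `hslim`),
and conversely `s^alg([z,b]·k) = γ(β)β⁻¹·s^alg(k)` with `γ = conj(z)`.
[cite: MochizukiEtTh2009, Prop 2.14(i) p.49] -/
theorem prop214_i_of_commutators
    (hslim : ∀ z : R.PiX, (∀ y : R.PiY, R.aug (z * y * z⁻¹) = R.aug y) → R.aug z = 1)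
    (hcomm : ∀ t : R.PiX, t ∈ R.lDeltaTheta ↔
      ∃ z ∈ R.aug.ker, ∃ b ∈ R.PiY ⊓ R.aug.ker, ∃ k ∈ R.thetaKer, t = z * b * z⁻¹ * b⁻¹ * k) :
    R.Prop214_i := by
  intro x
  constructor
  · rintro ⟨γ, ⟨hγc, hγD, hγG⟩, β, hβ, k, ⟨kdd, hkdd', rfl⟩, rfl⟩
    have hkdd : (kdd : R.PiX) ∈ R.thetaKer := Subgroup.mem_subgroupOf.mp hkdd'
    obtain ⟨z, hr, hμ, hv⟩ := R.toThetaEnvData.aut_shape_of_mk_mem_DY ⟨γ, hγc⟩ hγD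
    have hr' : ∀ y : R.env, (((γ y).right : R.PiY) : R.PiX) = z * (y.right : R.PiX) * z⁻¹ := hr
    have hμ' : ∀ a : R.mu, γ (CycEnvelope.inMu R.augY R.chi a) =
        CycEnvelope.inMu R.augY R.chi (R.chi (R.aug z) a) := hμ
    have hv' : ∀ b : R.PiY, R.augY b = 1 →
        (γ (CycEnvelope.algSection R.augY R.chi b)).left = 1 := hv
    -- `aug z = 1`: `γ` is over `G_K`
    have hz : R.aug z = 1 := by
      refine hslim z fun y => ?_
      have h := hγG (CycEnvelope.algSection R.augY R.chi y)
      change R.aug (((γ (CycEnvelope.algSection R.augY R.chi y)).right : R.PiY) : R.PiX) =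
        R.aug (((CycEnvelope.algSection R.augY R.chi y).right : R.PiY) : R.PiX) at h
      rwa [hr', SemidirectProduct.right_inr] at h
    have hβr : R.aug ((β.right : R.PiY) : R.PiX) = 1 := (CycEnvelope.mem_deltaEnv_iff _ _ β).mp hβ
    have hright : (((γ β).right : R.PiY) : R.PiX) = z * (β.right : R.PiX) * z⁻¹ := hr' β
    have hleft : (γ β).left = β.left := by
      have hγβ : γ β = γ (CycEnvelope.inMu R.augY R.chi β.left) *
          γ (CycEnvelope.algSection R.augY R.chi β.right) := by
        conv_lhs => rw [← CycEnvelope.inMu_mul_algSection R.augY R.chi β]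
        rw [map_mul]
      rw [hγβ, SemidirectProduct.mul_left, hμ', hv' β.right hβr, hz]
      simp
    -- the element `t = [z, β̄] · k ∈ (l·Δ_Θ)·Ker`
    have htL : z * (β.right : R.PiX) * z⁻¹ * (β.right : R.PiX)⁻¹ * kdd ∈ R.lDeltaTheta :=
      (hcomm _).mpr ⟨z, hz, _, ⟨(β.right : R.PiY).2, hβr⟩, _, hkdd, rfl⟩
    refine ⟨⟨_, (R.lDeltaTheta_le htL).1⟩, Subgroup.mem_subgroupOf.mpr htL, ?_⟩
    have haug1 : R.aug (((γ β).right : R.PiY) : R.PiX) = 1 := by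
      rw [hright, map_mul, map_mul, map_inv, hz, hβr]; simp
    ext
    · simp only [ThetaEnvData.sAlg, MonoidHom.coe_comp, Function.comp_apply,
        SemidirectProduct.left_inr, SemidirectProduct.mul_left, SemidirectProduct.mul_right,
        SemidirectProduct.inv_left, hleft, Subgroup.coe_subtype, map_mul, map_inv, haug1, hβr,
        inv_one, mul_one, map_one, MulAut.one_apply, one_mul, mul_inv_cancel]
    · simp only [ThetaEnvData.sAlg, MonoidHom.coe_comp, Function.comp_apply,
        SemidirectProduct.right_inr, SemidirectProduct.mul_right, SemidirectProduct.inv_right,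
        Subgroup.coe_mul, Subgroup.coe_inv, hright]
      rfl
  · rintro ⟨g, hg, rfl⟩
    have hgL : (g : R.PiX) ∈ R.lDeltaTheta := Subgroup.mem_subgroupOf.mp hg
    obtain ⟨z, hz, b, hb, k, hk, hgeq⟩ := (hcomm _).mp hgL
    have hz1 : R.aug z = 1 := hz
    have hc : R.conjX z ∈ contMulAut R.env := R.toThetaEnvData.conjX_mem_contMulAut z
    refine ⟨R.conjX z, ⟨hc, ?_, ?_⟩, CycEnvelope.algSection R.augY R.chi ⟨b, hb.1⟩, ?_,
      R.toThetaEnvData.sAlg ⟨k, (R.thetaKer_le hk).1⟩,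
      ⟨⟨k, (R.thetaKer_le hk).1⟩, Subgroup.mem_subgroupOf.mpr hk, rfl⟩, ?_⟩
    · exact Subgroup.subset_closure (Or.inr ⟨z, hc, rfl⟩)
    · intro y
      change R.aug (z * ((y.right : R.PiY) : R.PiX) * z⁻¹) = R.aug ((y.right : R.PiY) : R.PiX)
      rw [map_mul, map_mul, map_inv, hz1]; simp
    · rw [CycEnvelope.mem_deltaEnv_iff]
      exact hb.2
    · ext
      · simp only [ThetaEnvData.sAlg, MonoidHom.coe_comp, Function.comp_apply,
          SemidirectProduct.left_inr, SemidirectProduct.mul_left, SemidirectProduct.mul_right,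
          SemidirectProduct.inv_left, SemidirectProduct.right_inr, Subgroup.coe_subtype, map_mul,
          map_inv, map_one, MulAut.one_apply, inv_one, mul_one, hz1, ThetaEnvData.conjX,
          MulEquiv.coe_mk, Equiv.coe_fn_mk]
      · simp only [ThetaEnvData.sAlg, MonoidHom.coe_comp, Function.comp_apply,
          SemidirectProduct.right_inr, SemidirectProduct.mul_right, SemidirectProduct.inv_right,
          Subgroup.coe_mul, Subgroup.coe_inv, ThetaEnvData.conjX, MulEquiv.coe_mk,
          Equiv.coe_fn_mk]
        exact hgeq

end RigidData

end Literature.AnabelianGeometry.EtaleTheta
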